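import Summits.BirchSwinnertonDyer.BirchSwinnertonDyer.Theorems.KimAtThreeDeepLowerExpStarOmegaTransport
import Summits.BirchSwinnertonDyer.BirchSwinnertonDyer.Theorems.KimAtThreeDeepLowerExpStarOmega
import Literature.NumberTheory.PAdicHodge.BdRBaseChangeFiltered
import Literature.NumberTheory.GaloisRepresentations.LocalKroneckerWeberInertiaProofs
import Literature.NumberTheory.GaloisRepresentations.PadicAlgebraOfLocalField
import HarnessLib

/-!
# (RES): `exp*_ω` commutes with restriction along a continuous embedding `K → L` of `p`-adic fields
# — the concrete half of `exp*`-functoriality in the field, for the tree's `B_dR(K) ≃ B_dR(L)`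
# (route `KimAtThreeKolyvagin`, rung W2; cell `bsd-addord`, seat w2-c2 gen 8)

HONEST FRAMING. Theorems only (no definition, no named fact, no `sorry`, no instance); nothing is closed or
booked; BSD is not proved by any of this.

The clause (RES) of the W2 residual packages — seat kim3's hKdef (RES_w) «`φ_w ∘ cohomologyRes = algebraMap ∘ e₃ ∘ φ`»
on crux 19560, and the (RES) inside the uniform road's X1-int_b on cruxes 19075 / 19076 — was listed as
«UNOWNED, typer-grade» (kim3 g14 dependency map (K3)).  It is a THEOREM: the tree already constructs, for a
continuous embedding `K → L` of `p`-adic fields, a filtered, `Γ_L`-equivariant, `ℚ_p`- and `K`-compatible ring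
isomorphism `Φ : B_dR(K) ≃ B_dR(L)` (`BdRBaseChangeFiltered.exists_fracBdR_ringEquiv_filtered`, Brinon–Conrad
Prop. 6.3.8), and the prequel `KimAtThreeDeepLowerExpStarOmegaTransport` transports Kato's relation along such a `Φ`.

* `logCyclotomic_absGaloisRestrict` — `log χ_cyclo` restricts (`cyclotomicCharacter_absGaloisRestrict`).
* `cohomologyRes_oneCocycleClass` — the tree's `ContinuousRep.cohomologyRes` on an explicit crossed homomorphism
  is the class of `η ∘ s`.
* `isScalarTower_padicAlgebra_of_continuous` — for the CANONICAL `ℚ_p`-structures (`LocalField.padicAlgebra`) a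
  continuous `K → L` is automatically `ℚ_p`-linear (uniqueness of the continuous `ℚ_p → L`).
* ★ `exists_localNeronLine_expStarOmega_res` — **(RES)**: for `hcont : Continuous (algebraMap K L)`,
  `[IsScalarTower ℚ_[p] K L]`, a Néron line `d_K` over `K` and ANY Néron line over `L` (only its existence is used:
  `dim D⁰_dR = 1` over `L`), there is a Néron line `d_L` over `L` — the transported generator `(Φ ⊗ id) ω_K` —
  such that for every class `y`, under the Prop-1.2.3 binders on both sides,
  `expStarOmega hL (r.comp (absGaloisRestrict K L)) d_L (cohomologyRes _ (absGaloisRestrict K L) 1 y)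
   = algebraMap K L (expStarOmega hK r d_K y)`.
  At `K = ℚ_v`, `L = L_w = w.adicCompletion (ℚ(ζ_m))`, `r = galRestrictPlace v` this is kim3's (RES_w) and the
  uniform road's (RES) (the tower `(tateLocalRep W p (inr v)).restrict s` is `localTateRep W p (r.comp s)` by
  `localTateRep_comp`).

References: K. Kato, LNM 1553 (1993), Ch. II §1.2.4, Prop. 1.2.3 [Kato1993LNM1553]; O. Brinon, B. Conrad, *CMI
notes* (2009), Prop. 6.3.8 [BrinonConrad2009]; J.-M. Fontaine, Astérisque 223 (1994), Exp. II §1.5, Exp. III §1.5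
[FontaineAsterisque223III]; J.-P. Serre, *Local Fields*, II §5 [SerreLocalFields1979].
-/

set_option autoImplicit false
-- the Theorems namespace of a single-conjunct summit repeats the summit name by design (D-0017)
set_option linter.dupNamespace false

noncomputable section

open scoped TensorProduct
open Field ValuativeRel Function WittVector
open Literature.NumberTheory.GaloisRepresentations
open Literature.NumberTheory.GaloisRepresentations.PeriodRingData
open Literature.NumberTheory.PAdicHodge
open Literature.NumberTheory.EllipticCurves
open Summit.BirchSwinnertonDyer.BirchSwinnertonDyer.Theorems.KimAtThreeDeepLowerExpStarOmega
open Summit.BirchSwinnertonDyer.BirchSwinnertonDyer.Theorems.KimAtThreeDeepLowerExpStarOmegaTransport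

namespace Summit.BirchSwinnertonDyer.BirchSwinnertonDyer.Theorems.KimAtThreeDeepLowerExpStarOmegaRes

/-! ### Small inputs -/

section Inputs

variable {K L : Type} [Field K] [Field L] [Algebra K L] (p : ℕ) [Fact p.Prime] [CharZero K]

/-- **`log χ_cyclo` restricts**: `log χ_L(τ) = log χ_K(res τ)` (`cyclotomicCharacter_absGaloisRestrict`).
[cite: Kato1993LNM1553, Ch. II §1.2.2] -/
theorem logCyclotomic_absGaloisRestrict (τ : absoluteGaloisGroup L) :
    logCyclotomic p τ = logCyclotomic p (absGaloisRestrict K L τ) := by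
  haveI : NeZero (p : K) := ⟨Nat.cast_ne_zero.2 (Fact.out : p.Prime).ne_zero⟩
  unfold logCyclotomic
  rw [cyclotomicCharacter_absGaloisRestrict K L p τ]

end Inputs

section Res

universe u

variable {G H : Type u} [Group G] [TopologicalSpace G] [IsTopologicalGroup G]
  [Group H] [TopologicalSpace H] [IsTopologicalGroup H]
  {V : Type u} [AddCommGroup V] [TopologicalSpace V] [IsTopologicalAddGroup V]

/-- **Restriction on explicit crossed homomorphisms**: the tree's `ContinuousRep.cohomologyRes τ φ 1` sends the
class of `η` to the class of `η ∘ φ` (Mathlib functoriality `map_oneCocycleClass`). [folklore] -/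
theorem cohomologyRes_oneCocycleClass (τ : ContinuousRep G ℤ V) (φ : H →ₜ* G)
    (η : contOneCocycles τ.toTopRep) :
    τ.cohomologyRes φ 1 (oneCocycleClass τ.toTopRep η) =
      oneCocycleClass (τ.restrict φ).toTopRep
        (contOneCocycles.pullback φ (Y := (τ.restrict φ).toTopRep)
          (TopRep.ofHom ⟨ContinuousLinearMap.id ℤ V, fun _ => rfl⟩) η) :=
  map_oneCocycleClass τ.toTopRep φ _ η

omit [IsTopologicalGroup G] [IsTopologicalGroup H] in
/-- Values of the restricted crossed homomorphism: `(η ∘ φ)(h) = η (φ h)`. [folklore] -/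
theorem pullback_id_apply (τ : ContinuousRep G ℤ V) (φ : H →ₜ* G) (η : contOneCocycles τ.toTopRep) (h : H) :
    (contOneCocycles.pullback φ (Y := (τ.restrict φ).toTopRep)
      (TopRep.ofHom ⟨ContinuousLinearMap.id ℤ V, fun _ => rfl⟩) η).1 h = η.1 (φ h) := rfl

end Res

/-! ### The canonical `ℚ_p`-structures form a tower along a continuous `K → L` -/

section Tower

variable {K L : Type} [Field K] [ValuativeRel K] [TopologicalSpace K] [IsNonarchimedeanLocalField K] [CharZero K]
  [Field L] [ValuativeRel L] [TopologicalSpace L] [IsNonarchimedeanLocalField L] [CharZero L] [Algebra K L]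
  (p : ℕ) [Fact p.Prime]

/-- **A continuous `K → L` is `ℚ_p`-linear for the CANONICAL `ℚ_p`-structures** (`LocalField.padicAlgebra`): the
composite `ℚ_p → K → L` is continuous, hence is THE continuous `ℚ_p → L` (`LocalField.eq_padicRingHom_of_continuous`).
Serre, *Local Fields*, II §5. [folklore] -/
theorem isScalarTower_padicAlgebra_of_continuous (hcont : Continuous (algebraMap K L))
    (hK : valuation K p < 1) (hL : valuation L p < 1) :
    letI := LocalField.padicAlgebra K p hK
    letI := LocalField.padicAlgebra L p hL
    IsScalarTower ℚ_[p] K L := by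
  letI := LocalField.padicAlgebra K p hK
  letI := LocalField.padicAlgebra L p hL
  refine IsScalarTower.of_algebraMap_eq' ?_
  have h := LocalField.eq_padicRingHom_of_continuous L p hL ((algebraMap K L).comp (algebraMap ℚ_[p] K))
    (hcont.comp (LocalField.continuous_padicRingHom K p hK))
  exact h.symm

end Tower

/-! ### (RES) for `exp*_ω` -/

section ExpStarRes

variable {K L : Type} [Field K] [ValuativeRel K] [TopologicalSpace K] [IsNonarchimedeanLocalField K] [CharZero K]
  [Field L] [ValuativeRel L] [TopologicalSpace L] [IsNonarchimedeanLocalField L] [CharZero L] [Algebra K L]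
  {p : ℕ} [Fact p.Prime]
  [Fact (¬ IsUnit (p : integerC K))] [IsAdicComplete (Ideal.span {(p : integerC K)}) (integerC K)]
  [Fact (¬ IsUnit (p : integerC L))] [IsAdicComplete (Ideal.span {(p : integerC L)}) (integerC L)]
  [Algebra ℚ_[p] K] [Algebra ℚ_[p] L] [IsScalarTower ℚ_[p] K L]
  (hK : valuation K p < 1) (hL : valuation L p < 1)
  (W : WeierstrassCurve ℚ) [W.IsElliptic] (r : absoluteGaloisGroup K →ₜ* absoluteGaloisGroup ℚ)

/-- ★ **(RES): `exp*_ω` commutes with restriction along a continuous embedding `K → L` of `p`-adic fields.**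
Given a Néron line `d_K` of `V_pW|_r` over `K` and the existence of one over `L` (`dim D⁰_dR(V_pW|_{r ∘ res}) = 1`),
there is a Néron line `d_L` over `L` — the generator `(Φ ⊗ id) ω_K` transported along the tree's filtered equivariant
`Φ : B_dR(K) ≃ B_dR(L)` — such that for every class `y ∈ H¹(Γ_K, T_pW|_r)`, under the Prop-1.2.3 binders
(injectivity of `∪ log χ` over `K` and over `L`, a dual exponential for every crossed homomorphism over `K`):
`exp*_{ω_L}(res y) = (K → L)(exp*_{ω_K}(y))`. [cite: Kato1993LNM1553, Ch. II §1.2.4 and Prop. 1.2.3]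
[cite: BrinonConrad2009, Prop. 6.3.8] -/
theorem exists_localNeronLine_expStarOmega_res (hcont : Continuous (algebraMap K L)) (dK : LocalNeronLine W hK r)
    (hdimL : Nonempty (LocalNeronLine W hL (r.comp (absGaloisRestrict K L)))) :
    ∃ dL : LocalNeronLine W hL (r.comp (absGaloisRestrict K L)),
      ∀ (_hinjK : (bdRPeriodRingData hK).CupLogInjective (logCyclotomic p) (localRationalTateRep W p r))
        (_hinjL : (bdRPeriodRingData hL).CupLogInjective (logCyclotomic p)
          (localRationalTateRep W p (r.comp (absGaloisRestrict K L))))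
        (_hexK : ∀ z : contOneCocycles (localRationalTateRep W p r).toTopRep,
          (bdRPeriodRingData hK).HasDualExp (logCyclotomic p) (localRationalTateRep W p r) fun σ => z.1 σ)
        (y : (localTateRep W p r).cohomology 1),
        expStarOmega hL (r.comp (absGaloisRestrict K L)) dL
            ((localTateRep W p r).cohomologyRes (absGaloisRestrict K L) 1 y) =
          algebraMap K L (expStarOmega hK r dK y) := by
  have hFK : Surjective (fontaineTheta (integerC K) p) := surjective_fontaineTheta_integerC hK
  have hFL : Surjective (fontaineTheta (integerC L) p) := surjective_fontaineTheta_integerC hL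
  haveI := isDomain_bDeRhamPlus hFK
  haveI := isDomain_bDeRhamPlus hFL
  obtain ⟨Φ, hΦs, -, -, hΦK, hΦfil⟩ := exists_fracBdR_ringEquiv_filtered (ℓ := p) hcont hK hL hFK hFL
  obtain ⟨d₀'⟩ := hdimL
  -- `Φ` as a ring homomorphism between the period rings of the two data (`(bdRPeriodRingData _).B = FracBdR _ p`)
  let Φr : (bdRPeriodRingData hK).B →+* (bdRPeriodRingData hL).B := Φ.toRingHom
  have hΦr : ∀ b, Φr b = Φ b := fun _ => rfl
  -- the three compatibilities of `Φ`, in the period-ring-data currency of `bdRPeriodRingData`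
  have hΦE : ∀ e : K, Φr (algebraMap K (bdRPeriodRingData hK).B e) =
      algebraMap L (bdRPeriodRingData hL).B (algebraMap K L e) := fun e => by
    rw [hΦr]
    exact hΦK e
  have hΦs' : ∀ (τ : absoluteGaloisGroup L) (b : (bdRPeriodRingData hK).B),
      Φr (absGaloisRestrict K L τ • b) = τ • Φr b := fun τ b => by
    rw [hΦr, hΦr]
    exact hΦs τ b
  have hΦfil' : ∀ b, b ∈ (bdRPeriodRingData hK).fil 0 → Φr b ∈ (bdRPeriodRingData hL).fil 0 :=
    fun b hb => by
      rw [hΦr]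
      exact (hΦfil 0 b).1 hb
  have hΦinj : Injective Φr := fun a b h => Φ.injective (by rwa [hΦr, hΦr] at h)
  have hψ : ∀ τ : absoluteGaloisGroup L, logCyclotomic p τ = logCyclotomic p (absGaloisRestrict K L τ) :=
    logCyclotomic_absGaloisRestrict p
  -- the transported generator
  refine ⟨filZeroLineTransport (absGaloisRestrict K L) (localRationalTateRep W p r) Φr hΦE hΦs' hΦfil' hΦinj
    dK d₀', fun hinjK hinjL hexK y => ?_⟩
  obtain ⟨η, rfl⟩ := oneCocycleClass_surjective _ y
  -- the restricted crossed homomorphism `η ∘ res`, as a cocycle of `localTateRep W p (r ∘ res)` (same type, `rfl`)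
  let η' : contOneCocycles (localTateRep W p (r.comp (absGaloisRestrict K L))).toTopRep :=
    contOneCocycles.pullback (absGaloisRestrict K L) (Y := ((localTateRep W p r).restrict (absGaloisRestrict K L)).toTopRep)
      (TopRep.ofHom ⟨ContinuousLinearMap.id ℤ (W.tateModule p), fun _ => rfl⟩) η
  have hres : (localTateRep W p r).cohomologyRes (absGaloisRestrict K L) 1 (oneCocycleClass _ η) =
      oneCocycleClass (localTateRep W p (r.comp (absGaloisRestrict K L))).toTopRep η' :=
    cohomologyRes_oneCocycleClass _ _ η
  rw [hres, expStarOmega_oneCocycleClass, expStarOmega_oneCocycleClass]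
  have hz : (fun σ => (pushRational p η').1 σ) = fun σ => (pushRational p η).1 (absGaloisRestrict K L σ) := rfl
  rw [hz]
  exact dualExpCoord_filZeroLineTransport (absGaloisRestrict K L) (localRationalTateRep W p r) Φr hΦE hΦs'
    hΦfil' hΦinj dK d₀' hψ hinjK hinjL (hexK (pushRational p η))

end ExpStarRes

end Summit.BirchSwinnertonDyer.BirchSwinnertonDyer.Theorems.KimAtThreeDeepLowerExpStarOmegaRes

end
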